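import Summits.BirchSwinnertonDyer.BirchSwinnertonDyer.Theorems.GenusKolyvaginAtTwoPowDvdShaCardAtTwoRTBottomRungEngine
import Summits.BirchSwinnertonDyer.BirchSwinnertonDyer.Theorems.GenusKolyvaginAtTwoPowDvdShaCardAtTwoRTFullOrderPairChebotarev
import Summits.BirchSwinnertonDyer.BirchSwinnertonDyer.Theorems.GenusKolyvaginAtTwoEquivariantKolyvaginExactAtTwoEigenClassesFinite
import Summits.BirchSwinnertonDyer.BirchSwinnertonDyer.Theorems.GenusKolyvaginAtTwoEquivariantKolyvaginExactAtTwoCebotarevVisibleRat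
import Summits.BirchSwinnertonDyer.BirchSwinnertonDyer.Theorems.Rank1ResidualJetConjActPlaceUnramified
import Summits.BirchSwinnertonDyer.BirchSwinnertonDyer.Theorems.CMKolyvaginAtInertTwoRationalDescentAtTwoTower
import Literature.NumberTheory.EllipticCurves.HeegnerPointsKolyvaginInvisibleLocalProofs
import HarnessLib

/-!
# Route `GenusKolyvaginAtTwo`, crux L_T `PowDvdShaCardAtTwoRT` (stmt-BirchSwinnertonDyer-23242), LINE 18 stub L, bottom rung:
# THE ONE-STEP ENGINE WITH THE ČEBOTAREV PRIME CHOSEN INSIDE, and the NON-PHANTOM hypothesis (NPh) that discharges `hres`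

LEAD seat `bsd-line-gk2-p1` g17 (cell `bsd-f1-sign2`), `--supports 23242 --as helper`.  THEOREMS ONLY; no `sorry`; standard axioms.
BSD is NOT proved by any of this; neither is the crux nor stub L.

WHY (memo `Cruxes/PowDvdShaCardAtTwoRT/Lines/plus-descent-lead-g17.md` §2, §4).  g16's `RelaxedCount.false_of_bottomRung_engine`
(`…RTBottomRungEngine`) displays ONE step-hypothesis whose (Čeb) clauses — a new Gross–Kolyvagin prime `ℓ′` of index `≥ 2` at whose
inert place `c(n)` and `res_K y` both have local order EXACTLY `4` — are exactly the output of gk2-p2's opposite-sign full-order pair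
Čebotarev `PlusDescent.infinite_kolyvaginPrime_localization_fullOrder_pair` (signed Q5R by name).  Its only non-formal input is Q5R's
separation hypothesis `hres` on `⟨c(n), res_K y⟩`; §1–§2 below show that `hres` follows from the single displayed hypothesis
**(NPh) «a class of `H¹(K, E[4])` that dies on `Γ_{K(E[4])}` and satisfies the Selmer condition at every finite place is zero»**,
because a class dying on `Γ_{K(E[4])}` is locally ZERO at every place over a Zhang–Kolyvagin prime of index `≥ 2` (the place splits
completely in `K(E[4])`: `JET.GlobalDuality.galoisRep_toLocal_apply_eq_self`), while `c(n)` and `res_K y` are Kummer elsewhere.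
* §1 `mem_torsionLocalKer_of_forall_h1Eval_eq_zero_of_isKolyvaginPrime` — Φ-KILL at the same level: phantom ⟹ `torsionLocalKer` at `λ ∋ ℓ`,
  `ℓ` Zhang–Kolyvagin of index `≥ k`.
* §2 `eq_zero_of_phantom_of_kummerOutside` — (NPh) ⟹ `hres`-shape vanishing for a class Kummer off a set of index-≥2 Kolyvagin places.
* §3 **`false_of_bottomRung_engine_cheb`** — the engine with `ℓ′` chosen inside; displayed: (NPh), the class `c(n)` (order `4`, Kolyvagin
  sign, Selmer off `s ∪ t`), and the `K`-side bookkeeping clauses as a function of `ℓ′` ((desc), (Kum), (Q2@λ′), (free)+(M), (tr)).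
Namespace `…Theorems.GenusExact.RelaxedCount`.  Closes nothing.  BSD is NOT proved by any of this.

References: [McCallumLMS1991] §3 Cor. 3.2, §5 proof of Prop. 5.2; [GrossLMS1991] §3 (3.3), Prop. 6.2, §9 Prop. 9.6;
[LawsonWuthrich2016] Lemma 6 (classes dying on the torsion field); [MilneADT2006] I Thm. 4.10.
-/

set_option autoImplicit false
-- the Theorems namespace of this sub repeats the summit name by design (D-0017 nested layout)
set_option linter.dupNamespace false

noncomputable section

open scoped Classical

open Field NumberField IsDedekindDomain Function WeierstrassCurve Rat.HeightOneSpectrum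
open Literature.NumberTheory.EllipticCurves
open Literature.NumberTheory.GaloisRepresentations
open Literature.NumberTheory.GaloisCohomology
open Summit.BirchSwinnertonDyer.Rank1Residual.X11b.Relaxation
open Summit.BirchSwinnertonDyer.BirchSwinnertonDyer.Theorems.GenusExact.SelmerDescent
open Summit.BirchSwinnertonDyer.BirchSwinnertonDyer.Theorems.GenusExact.VisiblePairAtTwo
  (natCast_mem_primesEquiv_symm natGenerator_eq_of_natCast_prime_mem liesOver_of_natCast_mem natCast_mem_of_liesOver
    exists_natCast_mem intCast_notMem_of_not_dvd)
open Summit.BirchSwinnertonDyer.Rank1Residual.JET.GlobalDuality (galoisRep_toLocal_apply_eq_self)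
open Summit.BirchSwinnertonDyer.BirchSwinnertonDyer.Theorems.KolyvaginRatDescentTwo (resTorsion_mem_selmerLocalKer_of_under)

namespace Summit.BirchSwinnertonDyer.BirchSwinnertonDyer.Theorems.GenusExact.RelaxedCount

variable (W : WeierstrassCurve ℚ) [W.IsElliptic] [W.IsGloballyMinimal]

/-! ## §1 Φ-KILL: a class dying on `Γ_{K(E[2^k])}` is locally zero at every place over a Zhang–Kolyvagin prime of index `≥ k` -/

/-- **Φ-KILL (same level).** `K` imaginary quadratic, `ℓ` a Zhang–Kolyvagin prime at `2` of index `≥ k`, `w ∋ ℓ` its place of `K`.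
If `z ∈ H¹(K, E[2^k])` has `[z, ρ] = 0` for every `ρ ∈ Γ_{K(E[2^k])}` (the chosen cocycle vanishes on the torsion-fixing subgroup), then
`z` is locally ZERO at `w`: `Γ_{K_w}` fixes `E[2^k]` (`galoisRep_toLocal_apply_eq_self`; the place `w` splits completely in `K(E[2^k])`), so
the restricted cocycle is identically zero (`mem_torsionLocalKer_of_forall_h1Eval_eq_zero`).  In particular the phantom class
`ι φ₂|_K` (Lawson–Wuthrich) is invisible at every such place. [cite: McCallumLMS1991, §3 (3) and Prop. 4.4 (proof)]
[cite: LawsonWuthrich2016, Lemma 6] -/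
theorem mem_torsionLocalKer_of_forall_h1Eval_eq_zero_of_isKolyvaginPrime {K : Type} [Field K] [NumberField K]
    (hK : IsImaginaryQuadratic K) {k ℓ : ℕ} (hℓ : Zhang2014.IsKolyvaginPrime (W.conductorNorm ℤ) W K 2 ℓ)
    (hk : k ≤ Zhang2014.kolyvaginIndex W 2 ℓ) (w : HeightOneSpectrum (𝓞 K)) (hw : (ℓ : 𝓞 K) ∈ w.asIdeal)
    {z : galH1Torsion (W.baseChange K) ((2 ^ k : ℕ) : ℤ)}
    (hz : ∀ ρ ∈ torsionFixing (W.baseChange K) ((2 ^ k : ℕ) : ℤ), h1Eval (W.baseChange K) ((2 ^ k : ℕ) : ℤ) z ρ = 0) :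
    z ∈ (W.baseChange K).torsionLocalKer (w.adicCompletion K) ((2 ^ k : ℕ) : ℤ) := by
  haveI : Fact (Nat.Prime 2) := ⟨Nat.prime_two⟩
  refine mem_torsionLocalKer_of_forall_h1Eval_eq_zero (W.baseChange K) _ w hz fun g ↦ ?_
  rw [mem_torsionFixing_iff]
  intro P
  exact galoisRep_toLocal_apply_eq_self W K hK hℓ hk w hw g P

/-! ## §2 (NPh) discharges the separation hypothesis for classes Kummer off a set of deep Kolyvagin places -/

/-- **(NPh) ⟹ vanishing of phantom classes that are Kummer off deep places.**  `K` imaginary quadratic; `T` a finite set of places of `ℚ`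
each lying under a Zhang–Kolyvagin prime of index `≥ 2`; (NPh): every class of `H¹(K, E[4])` dying on `Γ_{K(E[4])}` and Selmer at every
finite place is zero.  Then a class `z` dying on `Γ_{K(E[4])}` and Selmer at every finite place NOT over `T` is zero — at the places over
`T` it is locally zero by Φ-KILL (§1), hence Selmer there too.  This is the shape of Q5R's `hres` for the span of Kolyvagin classes
(Selmer off `n`) and restricted auxiliary classes (Kummer off `n`). [cite: McCallumLMS1991, §3 Cor. 3.2 (hypothesis (3))]
[cite: GrossLMS1991, §9 Prop. 9.6] -/
theorem eq_zero_of_phantom_of_selmer_outside {K : Type} [Field K] [NumberField K] (hK : IsImaginaryQuadratic K)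
    (T : Finset (Place ℚ))
    (hT : ∀ u ∈ T, ∃ (v : HeightOneSpectrum (𝓞 ℚ)) (ℓ : ℕ), u = Sum.inr v ∧ ℓ.Prime ∧ (ℓ : 𝓞 ℚ) ∈ v.asIdeal ∧
      Zhang2014.IsKolyvaginPrime (W.conductorNorm ℤ) W K 2 ℓ ∧ 2 ≤ Zhang2014.kolyvaginIndex W 2 ℓ)
    (hNPh : ∀ z : galH1Torsion (W.baseChange K) ((2 ^ 2 : ℕ) : ℤ),
      (∀ ρ ∈ torsionFixing (W.baseChange K) ((2 ^ 2 : ℕ) : ℤ), h1Eval (W.baseChange K) ((2 ^ 2 : ℕ) : ℤ) z ρ = 0) →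
      (∀ w : HeightOneSpectrum (𝓞 K), z ∈ selmerLocalKer (W.baseChange K) (w.adicCompletion K) ((2 ^ 2 : ℕ) : ℤ)) → z = 0)
    {z : galH1Torsion (W.baseChange K) ((2 ^ 2 : ℕ) : ℤ)}
    (hz : ∀ ρ ∈ torsionFixing (W.baseChange K) ((2 ^ 2 : ℕ) : ℤ), h1Eval (W.baseChange K) ((2 ^ 2 : ℕ) : ℤ) z ρ = 0)
    (hzK : ∀ w : HeightOneSpectrum (𝓞 K), (Sum.inr (w.under (𝓞 ℚ)) : Place ℚ) ∉ T →
      z ∈ selmerLocalKer (W.baseChange K) (w.adicCompletion K) ((2 ^ 2 : ℕ) : ℤ)) :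
    z = 0 := by
  refine hNPh z hz fun w ↦ ?_
  by_cases hw : (Sum.inr (w.under (𝓞 ℚ)) : Place ℚ) ∈ T
  · obtain ⟨v, ℓ, huv, hℓp, hℓv, hKol, hidx⟩ := hT _ hw
    have hvw : w.under (𝓞 ℚ) = v := Sum.inr_injective huv
    haveI : w.asIdeal.LiesOver v.asIdeal := ⟨by rw [← hvw]; rfl⟩
    have hℓw : (ℓ : 𝓞 K) ∈ w.asIdeal := natCast_mem_of_liesOver hℓv w
    exact (W.baseChange K).torsionLocalKer_le_selmerLocalKer (w.adicCompletion K) _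
      (mem_torsionLocalKer_of_forall_h1Eval_eq_zero_of_isKolyvaginPrime W hK hKol hidx w hℓw hz)
  · exact hzK w hw

/-! ## §3 The one-step engine with the Čebotarev prime chosen inside -/

/-- **The one-step engine of the bottom rung (index `≥ 2`, even depth), Čebotarev prime chosen INSIDE.**  Frame: `E/ℚ` globally minimal,
non-CM, `Δ < 0`, `ρ_{E,2^∞}` onto, `K = ℚ(θ)` imaginary quadratic (`θ² = c`, `c ≠ 1` its non-trivial automorphism, `d_K·(−|Δ|)` not a
square); `s ≠ ∅` (free) and `t` (deep) disjoint sets of places of Zhang–Kolyvagin primes of index `≥ 2` (`Frob = Frob_∞` on `E[4]` on `t`).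
Displayed inputs: the Kolyvagin class `cK = c(n)` — order `4` (primitivity), an eigenclass of complex conjugation (Kolyvagin's sign), Selmer
at every finite place not over `s ∪ t` (Gross 6.2(1) at `2`, odd Tamagawa); **(NPh)**: no non-zero class of `H¹(K,E[4])` dies on
`Γ_{K(E[4])}` and is Selmer at every finite place; and the `K`-side bookkeeping `hstep`: for every auxiliary `y` (Kummer off `s ∪ t`,
`2y ≠ 0`) a finite exceptional set `S₀` of primes, and for every Zhang–Kolyvagin prime `ℓ′ ∉ S₀` of index `≥ 2` with `Frob = Frob_∞` on
`E[4]`, place `v′ ∌` of `ℚ` outside `s ∪ t`, inert place `w′ ∣ v′`, at which `cK` and `res_K y` have local order exactly `4` — the classes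
`Z = desc c(nℓ′)`, `cK′ = c(nℓ′)`, `cKu = c((n/u)ℓ′)` with (desc), (Kum), (Q2@w′), (free)+(M), (tr).  THEN `False`: by (NPh) and Φ-KILL the
pair `(cK, res_K y)` satisfies Q5R's separation hypothesis, gk2-p2's full-order pair Čebotarev supplies infinitely many admissible `ℓ′`,
one avoids `S₀ ∪ {primes under s ∪ t} ∪ {ℓ ∣ c}`, and g16's `false_of_bottomRung_engine` concludes.  So a `k`-minimal primitive product has
no free own prime. [cite: McCallumLMS1991, §3 Cor. 3.2; §5 proof of Prop. 5.2] [cite: GrossLMS1991, Prop. 6.2 and §9] -/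
theorem false_of_bottomRung_engine_cheb [NeZero (W.conductorNorm ℤ)] (hcm : ¬ W.HasCM) (hΔ : W.Δ < 0)
    (hρ : ∀ n : ℕ, W.HasSurjectiveModNGaloisRep (2 ^ n : ℕ))
    {K : Type} [Field K] [NumberField K] (hK : IsImaginaryQuadratic K)
    (hns : ¬ IsSquare ((NumberField.discr K : ℚ) * -|W.Δ|))
    {θ : K} (hθ : θ ∉ (algebraMap ℚ K).range) {c : ℤ} (hc : θ ^ 2 = algebraMap ℚ K c)
    (σ : K ≃ₐ[ℚ] K) (hσ : σ ≠ 1)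
    (s t : Finset (Place ℚ)) (hst : Disjoint s t) (hs : s.Nonempty)
    (hTK : ∀ u ∈ s ∪ t, ∃ (v : HeightOneSpectrum (𝓞 ℚ)) (ℓ : ℕ) (_ : Fact ℓ.Prime), u = Sum.inr v ∧ ℓ ≠ 2 ∧ (ℓ : 𝓞 ℚ) ∈ v.asIdeal ∧
      W.HasGoodReductionAtPrime ℓ ∧ FrobEqFrobInfty W K 2 ℓ ∧ 2 ≤ Zhang2014.kolyvaginIndex W 2 ℓ ∧
      Zhang2014.IsKolyvaginPrime (W.conductorNorm ℤ) W K 2 ℓ)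
    (ht4 : ∀ (v : HeightOneSpectrum (𝓞 ℚ)) (ℓ : ℕ), ℓ.Prime → Sum.inr v ∈ t → (ℓ : 𝓞 ℚ) ∈ v.asIdeal →
      FrobEqFrobInfty W K (2 ^ 2) ℓ)
    -- the Kolyvagin class `c(n)` of the `k`-minimal primitive product: order `4`, eigen, Selmer off `s ∪ t`
    (cK : galH1Torsion (W.baseChange K) ((2 ^ 2 : ℕ) : ℤ)) (hcK4 : addOrderOf cK = 2 ^ 2)
    {sK : ℤ} (hsK : sK = 1 ∨ sK = -1) (hτcK : conjAct W σ ((2 ^ 2 : ℕ) : ℤ) cK = sK • cK)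
    (hcKsel : ∀ w : HeightOneSpectrum (𝓞 K), (Sum.inr (w.under (𝓞 ℚ)) : Place ℚ) ∉ s ∪ t →
      cK ∈ selmerLocalKer (W.baseChange K) (w.adicCompletion K) ((2 ^ 2 : ℕ) : ℤ))
    -- (NPh): no non-zero phantom class is Selmer at every finite place
    (hNPh : ∀ z : galH1Torsion (W.baseChange K) ((2 ^ 2 : ℕ) : ℤ),
      (∀ ρ ∈ torsionFixing (W.baseChange K) ((2 ^ 2 : ℕ) : ℤ), h1Eval (W.baseChange K) ((2 ^ 2 : ℕ) : ℤ) z ρ = 0) →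
      (∀ w : HeightOneSpectrum (𝓞 K), z ∈ selmerLocalKer (W.baseChange K) (w.adicCompletion K) ((2 ^ 2 : ℕ) : ℤ)) → z = 0)
    -- the `K`-side bookkeeping at the new prime, as a function of `ℓ′`
    (hstep : ∀ y ∈ kummerOutside W (2 ^ 2) (s ∪ t), 2 • y ≠ 0 → ∃ S₀ : Finset ℕ,
      ∀ (ℓ' : ℕ) (v' : HeightOneSpectrum (𝓞 ℚ)) (w' : HeightOneSpectrum (𝓞 K)), w'.asIdeal.LiesOver v'.asIdeal →
        ℓ' ∉ S₀ → ℓ'.Prime → (ℓ' : 𝓞 ℚ) ∈ v'.asIdeal → (ℓ' : 𝓞 K) ∈ w'.asIdeal →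
        Zhang2014.IsKolyvaginPrime (W.conductorNorm ℤ) W K 2 ℓ' → FrobEqFrobInfty W K (2 ^ 2) ℓ' →
        2 ≤ Zhang2014.kolyvaginIndex W 2 ℓ' → (Sum.inr v' : Place ℚ) ∉ s ∪ t →
        (∀ j : ℕ, ((2 ^ j : ℕ) : ℤ) • cK ∈ (W.baseChange K).torsionLocalKer (w'.adicCompletion K) ((2 ^ 2 : ℕ) : ℤ) ↔ 2 ≤ j) →
        (∀ j : ℕ, ((2 ^ j : ℕ) : ℤ) • resTorsion W K ((2 ^ 2 : ℕ) : ℤ) y ∈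
          (W.baseChange K).torsionLocalKer (w'.adicCompletion K) ((2 ^ 2 : ℕ) : ℤ) ↔ 2 ≤ j) →
        ∃ (Z : galoisCohomology (W.torsionGaloisModule ((2 ^ 2 : ℕ) : ℤ)) 1)
          (cK' : galH1Torsion (W.baseChange K) ((2 ^ 2 : ℕ) : ℤ)),
          resTorsion W K ((2 ^ 2 : ℕ) : ℤ) Z = cK' ∧
          (∀ v : HeightOneSpectrum (𝓞 ℚ), (Sum.inr v : Place ℚ) ∉ insert (Sum.inr v' : Place ℚ) (s ∪ t) →
            ∀ w : HeightOneSpectrum (𝓞 K), w.asIdeal.LiesOver v.asIdeal →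
              cK' ∈ selmerLocalKer (W.baseChange K) (w.adicCompletion K) ((2 ^ 2 : ℕ) : ℤ)) ∧
          (∀ j : ℕ,
            (((2 ^ j : ℕ) : ℤ) • cK' ∈ selmerLocalKer (W.baseChange K) (w'.adicCompletion K) ((2 ^ 2 : ℕ) : ℤ) ↔
              ((2 ^ j : ℕ) : ℤ) • cK' ∈ (W.baseChange K).torsionLocalKer (w'.adicCompletion K) ((2 ^ 2 : ℕ) : ℤ)) ∧
            (((2 ^ j : ℕ) : ℤ) • cK' ∈ (W.baseChange K).torsionLocalKer (w'.adicCompletion K) ((2 ^ 2 : ℕ) : ℤ) ↔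
              ((2 ^ j : ℕ) : ℤ) • cK ∈ (W.baseChange K).torsionLocalKer (w'.adicCompletion K) ((2 ^ 2 : ℕ) : ℤ))) ∧
          (∀ u ∈ s, ∃ (v : HeightOneSpectrum (𝓞 ℚ)) (ℓ : ℕ) (w : HeightOneSpectrum (𝓞 K)) (_ : w.asIdeal.LiesOver v.asIdeal)
            (cKu : galH1Torsion (W.baseChange K) ((2 ^ 2 : ℕ) : ℤ)),
            u = Sum.inr v ∧ ℓ.Prime ∧ (ℓ : 𝓞 ℚ) ∈ v.asIdeal ∧ ((c : ℤ) : 𝓞 ℚ) ∉ v.asIdeal ∧ FrobEqFrobInfty W K (2 ^ 2) ℓ ∧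
            w.asIdeal.inertiaDeg (𝓞 ℚ) = 2 ∧
            (((2 ^ 1 : ℕ) : ℤ) • cK' ∈ (W.baseChange K).torsionLocalKer (w.adicCompletion K) ((2 ^ 2 : ℕ) : ℤ) ↔
              ((2 ^ 1 : ℕ) : ℤ) • cKu ∈ (W.baseChange K).torsionLocalKer (w.adicCompletion K) ((2 ^ 2 : ℕ) : ℤ)) ∧
            (2 : ℤ) • cKu = 0) ∧
          (∀ v : HeightOneSpectrum (𝓞 ℚ), Sum.inr v ∈ t →
            ∀ 𝔓 ∈ v.primesAbove, ∀ F c₀ : absoluteGaloisGroup ℚ, IsArithFrobAt (𝓞 ℚ) F 𝔓 →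
              IsComplexConjugation (Rat.castHom ℝ) c₀ → (∀ P : geomTorsion W ((2 ^ 2 : ℕ) : ℤ), F • P = c₀ • P) →
              ∃ P₁ : geomTorsion W ((2 ^ 2 : ℕ) : ℤ), h1Eval W _ ((2 : ℕ) • Z) F = F • P₁ - P₁)) :
    False := by
  haveI : Fact (Nat.Prime 2) := ⟨Nat.prime_two⟩
  have h2K : Module.finrank ℚ K = 2 := hK.1
  haveI : IsGalois ℚ K := isGalois_of_finrank_eq_two K h2K
  have hρ2 : W.HasSurjectiveModNGaloisRep 2 := by simpa using hρ 1
  -- `θ ∉ ℚ` in the `Set.range` form, and `c ≠ 0`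
  have hθ' : θ ∉ Set.range (algebraMap ℚ K) := fun ⟨q, hq⟩ ↦ hθ ⟨q, hq⟩
  have hc0 : c ≠ 0 := by
    rintro rfl
    apply hθ
    refine ⟨0, ?_⟩
    have h0 : θ ^ 2 = 0 := by rw [hc]; simp
    rw [map_zero]
    exact (pow_eq_zero_iff two_ne_zero).mp h0 |>.symm
  -- `res_K` is injective at level `4` on the habitat (`E(K)[4] = 0`)
  have hinj : Function.Injective (resTorsion W K ((2 ^ 2 : ℕ) : ℤ)) :=
    (EigenClassesFinite.eigen_description_two_pow_of_hasSurjectiveModNGaloisRep_two W K h2K hθ'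
      (c := (c : ℚ)) (by exact_mod_cast hc) hρ2 2).1
  -- the frame data of `s ∪ t` in the two currencies
  have hTK₀ : ∀ u ∈ s ∪ t, ∃ (v : HeightOneSpectrum (𝓞 ℚ)) (ℓ : ℕ) (_ : Fact ℓ.Prime), u = Sum.inr v ∧ ℓ ≠ 2 ∧
      (ℓ : 𝓞 ℚ) ∈ v.asIdeal ∧ W.HasGoodReductionAtPrime ℓ ∧ FrobEqFrobInfty W K 2 ℓ ∧ 2 ≤ Zhang2014.kolyvaginIndex W 2 ℓ := by
    intro u hu
    obtain ⟨v, ℓ, hℓp, huv, hℓ2, hℓv, hgood, hFrob, hidx, -⟩ := hTK u hu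
    exact ⟨v, ℓ, hℓp, huv, hℓ2, hℓv, hgood, hFrob, hidx⟩
  have hTKol : ∀ u ∈ s ∪ t, ∃ (v : HeightOneSpectrum (𝓞 ℚ)) (ℓ : ℕ), u = Sum.inr v ∧ ℓ.Prime ∧ (ℓ : 𝓞 ℚ) ∈ v.asIdeal ∧
      Zhang2014.IsKolyvaginPrime (W.conductorNorm ℤ) W K 2 ℓ ∧ 2 ≤ Zhang2014.kolyvaginIndex W 2 ℓ := by
    intro u hu
    obtain ⟨v, ℓ, hℓp, huv, -, hℓv, -, -, hidx, hKol⟩ := hTK u hu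
    exact ⟨v, ℓ, huv, hℓp.out, hℓv, hKol, hidx⟩
  refine false_of_bottomRung_engine W hΔ hρ2 hK hθ hc s t hst hs hTK₀ ht4 fun y hyKO hy2 ↦ ?_
  -- ### the restricted auxiliary class: order `4`, `σ`-fixed, Selmer off `s ∪ t`
  set yK := resTorsion W K ((2 ^ 2 : ℕ) : ℤ) y with hyK_def
  have hyK2 : ¬ 2 ^ 1 • yK = 0 := by
    intro h
    apply hy2
    have h2 : resTorsion W K ((2 ^ 2 : ℕ) : ℤ) (2 • y) = 0 := by
      refine (map_nsmul (resTorsion W K ((2 ^ 2 : ℕ) : ℤ)) 2 y).trans ?_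
      rw [pow_one] at h
      exact h
    exact (injective_iff_map_eq_zero _).mp hinj _ h2
  have hyK4 : 2 ^ (1 + 1) • yK = 0 := by
    have h : (((2 ^ 2 : ℕ) : ℤ)) • yK = 0 := zsmul_discreteH1_torsion _ yK
    rw [natCast_zsmul] at h
    exact h
  have hyKord : addOrderOf yK = 2 ^ 2 := addOrderOf_eq_prime_pow hyK2 hyK4
  have hτyK : conjAct W σ ((2 ^ 2 : ℕ) : ℤ) yK = (1 : ℤ) • yK := by
    rw [one_zsmul]
    exact conjAct_resTorsion K W _ σ h2K hσ y
  have hySel : ∀ w : HeightOneSpectrum (𝓞 K), (Sum.inr (w.under (𝓞 ℚ)) : Place ℚ) ∉ s ∪ t →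
      yK ∈ selmerLocalKer (W.baseChange K) (w.adicCompletion K) ((2 ^ 2 : ℕ) : ℤ) := by
    intro w hw
    have hyv : y ∈ selmerLocalKer W ((w.under (𝓞 ℚ)).adicCompletion ℚ) ((2 ^ 2 : ℕ) : ℤ) :=
      (res_mem_kummerLocalConditionAt_iff W ((2 ^ 2 : ℕ) : ℤ) (Place.Completion (Sum.inr (w.under (𝓞 ℚ)) : Place ℚ)) y).mp
        ((mem_kummerOutside_iff W (2 ^ 2) (s ∪ t) y).mp hyKO _ hw)
    exact resTorsion_mem_selmerLocalKer_of_under K W _ w hyv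
  -- ### Q5R's separation hypothesis for `⟨cK, yK⟩`, from (NPh) and Φ-KILL
  have hres : ∀ a b : ℤ, (∀ ρ ∈ torsionFixing (W.baseChange K) ((2 ^ 2 : ℕ) : ℤ),
      h1Eval (W.baseChange K) ((2 ^ 2 : ℕ) : ℤ) (a • cK + b • yK) ρ = 0) → a • cK + b • yK = 0 := by
    intro a b hab
    refine eq_zero_of_phantom_of_selmer_outside W hK (s ∪ t) hTKol hNPh hab fun w hw ↦ ?_
    exact add_mem (AddSubgroup.zsmul_mem _ (hcKsel w hw) a) (AddSubgroup.zsmul_mem _ (hySel w hw) b)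
  -- ### the exceptional set and the Čebotarev prime
  obtain ⟨S₀, hS₀⟩ := hstep y hyKO hy2
  set Sst : Finset ℕ := ((s ∪ t).preimage Sum.inr Sum.inr_injective.injOn).image natGenerator with hSst_def
  set E : Finset ℕ := S₀ ∪ Sst ∪ c.natAbs.primeFactors with hE_def
  have hinf := PlusDescent.infinite_kolyvaginPrime_localization_fullOrder_pair (W.conductorNorm ℤ) W hcm hΔ K hK hns hρ σ hσ
    2 (by norm_num) cK yK (m := 2) (κ := 2) (by norm_num) (by norm_num) hcK4 hyKord hsK (Or.inl rfl) hτcK hτyK hres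
  obtain ⟨ℓ', hℓ'mem, hℓ'E⟩ := hinf.exists_notMem_finset E
  obtain ⟨hFrob', hKol', hidx', hloc'⟩ := hℓ'mem
  have hℓ'p : ℓ'.Prime := hKol'.1
  haveI : Fact ℓ'.Prime := ⟨hℓ'p⟩
  have hℓ'S₀ : ℓ' ∉ S₀ := fun h ↦ hℓ'E (by simp [hE_def, h])
  have hℓ'Sst : ℓ' ∉ Sst := fun h ↦ hℓ'E (by simp [hE_def, h])
  have hℓ'c : ¬ ((ℓ' : ℤ) ∣ c) := by
    intro h
    apply hℓ'E
    have : ℓ' ∈ c.natAbs.primeFactors :=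
      Nat.mem_primeFactors.mpr ⟨hℓ'p, Int.natCast_dvd.mp h, Int.natAbs_ne_zero.mpr hc0⟩
    simp [hE_def, this]
  -- the place `v′` of `ℚ` and the inert place `w′` of `K`
  set v' : HeightOneSpectrum (𝓞 ℚ) := primesEquiv.symm ⟨ℓ', hℓ'p⟩ with hv'_def
  have hℓ'v' : (ℓ' : 𝓞 ℚ) ∈ v'.asIdeal := natCast_mem_primesEquiv_symm hℓ'p
  have hv'out : (Sum.inr v' : Place ℚ) ∉ s ∪ t := by
    intro h
    apply hℓ'Sst
    rw [hSst_def, Finset.mem_image]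
    refine ⟨v', Finset.mem_preimage.mpr h, natGenerator_eq_of_natCast_prime_mem hℓ'p hℓ'v'⟩
  obtain ⟨w', hℓ'w'⟩ := exists_natCast_mem (K := K) hℓ'p
  haveI hw'v' : w'.asIdeal.LiesOver v'.asIdeal := liesOver_of_natCast_mem hℓ'p hℓ'v' hℓ'w'
  have hf' : w'.asIdeal.inertiaDeg (𝓞 ℚ) = 2 :=
    inertiaDeg_eq_two_of_span_isPrime h2K hℓ'p hKol'.2.2.2.2.1 hℓ'v' hℓ'w'
  have hℓ'2 : ℓ' ≠ 2 := hKol'.2.2.2.1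
  have hgood' : W.HasGoodReductionAtPrime ℓ' := hasGoodReductionAtPrime_of_not_dvd_conductorNorm W hKol'.2.1
  have hcv' : ((c : ℤ) : 𝓞 ℚ) ∉ v'.asIdeal := intCast_notMem_of_not_dvd hℓ'p hℓ'v' hℓ'c
  obtain ⟨hOrdZ, hOrdY⟩ := hloc' w' hℓ'w'
  -- ### the bookkeeping at `ℓ′`
  obtain ⟨Z, cK', hZ, hKum, hRel, hfree, htr⟩ :=
    hS₀ ℓ' v' w' hw'v' hℓ'S₀ hℓ'p hℓ'v' hℓ'w' hKol' hFrob' hidx' hv'out hOrdZ hOrdY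
  exact ⟨v', ℓ', ⟨hℓ'p⟩, w', hw'v', Z, cK, cK', hv'out, hℓ'2, hℓ'v', hgood', hcv', hFrob', hidx', hf', hZ, hKum, hRel, hOrdZ,
    hOrdY, hfree, htr⟩

end Summit.BirchSwinnertonDyer.BirchSwinnertonDyer.Theorems.GenusExact.RelaxedCount

end
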